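import Summits.Ventures.PercRepro.S1CoreCapEightThreeMeet

/-!
# PercRepro — THE EXACT VALUE `Q*(8) = 23`: TWO BIG LINES MEET, THE THIRD IS IN NO PLANE WITH THEM (p1, gen 29)

The sharpening of `S1CoreCapEightThreeMeet` from `25` (table maximum `24`) to `23` — case (A1) of the three
non-planar big lines. Everything is as there (the plane `Π` on `[B, A]`, the third line `C` after it, the
bridge chords `Tα` and the thin lines `Tβ` outside `P₁ = C ∪ Π` at budget `b′ ≤ 2`, the hub device of
`S1CoreCapEightHub`); the one new fact is THE FAT OF THE CHORDS ON `P₁`: the chords through one hub are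
pairwise disjoint off it, so each fat point of `P₁` lies on at most one chord per hub —
`Σ_{Z ∈ Tα} fat (Z ∩ P₁) ≤ fat P₁ · #hubs` (`sum_fat_inter_le_hubs`) — in place of the crude `fat P₁` per
chord. The chord family's cap is then `≤ |C ∖ Π| · b′ + #hubs · fat P₁` and the table over
`(c, f₀, |C|, fat (C ∖ Π), |C ∩ Π|, b′, #hubs)` reads `≤ 23` (`sum_cap_le_twenty_three_of_three_big_meet`;
`work/exact/table3.py` of the seat is the brute force of the same inequalities). `proofs/P1-S4-CAPBRIDGE.md`
§21. Axioms: standard.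
-/

namespace PercRepro

namespace S1

namespace FourCap

namespace Eight

open Seven

variable {β : Type} [DecidableEq β]

/-- **The fat points of `P₁` on a chord family**: the chords through one hub are pairwise disjoint off it, so a
fat point of `P₁` lies on at most one chord per hub — `Σ_{Z ∈ T} fat (Z ∩ P₁) ≤ fat P₁ · #hubs`. -/
theorem sum_fat_inter_le_hubs (w : β → ℕ) (P₁ : Finset β) {T : Finset (Finset β)}
    (hT : ∀ Z ∈ T, Z.card = 3 ∧ (Z ∩ P₁).card = 2)
    (hpair : ∀ Z ∈ T, ∀ Z' ∈ T, Z ≠ Z' → (Z ∩ Z').card ≤ 1) :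
    ∑ Z ∈ T, fat w (Z ∩ P₁) ≤ fat w P₁ * (T.image (fun Z => Z \ P₁)).card := by
  have hline : ∀ Z ∈ T, fat w (Z ∩ P₁) = ∑ p ∈ P₁.filter (fun u => w u = 2), if p ∈ Z then 1 else 0 := by
    intro Z _
    unfold fat
    have e : (Z ∩ P₁).filter (fun u => w u = 2) = (P₁.filter (fun u => w u = 2)).filter (fun p => p ∈ Z) := by
      ext u
      simp only [Finset.mem_filter, Finset.mem_inter]
      tauto
    rw [e, Finset.card_filter]
  rw [Finset.sum_congr rfl hline, Finset.sum_comm]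
  have hdeg : ∀ p ∈ P₁.filter (fun u => w u = 2),
      (∑ Z ∈ T, if p ∈ Z then 1 else 0) ≤ (T.image (fun Z => Z \ P₁)).card := by
    intro p hp
    have hpP : p ∈ P₁ := (Finset.mem_filter.1 hp).1
    rw [← Finset.card_filter]
    have hmaps : ∀ Z ∈ T.filter (fun Z => p ∈ Z), Z \ P₁ ∈ T.image (fun Z => Z \ P₁) :=
      fun Z hZ => Finset.mem_image_of_mem _ (Finset.mem_filter.1 hZ).1
    have hinj : Set.InjOn (fun Z : Finset β => Z \ P₁) (T.filter (fun Z => p ∈ Z)) := by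
      intro Z hZ Z' hZ' hZZ'
      by_contra hne
      simp only at hZZ'
      have hZm := Finset.mem_filter.1 hZ
      have hZ'm := Finset.mem_filter.1 hZ'
      obtain ⟨hZ3, hZ2⟩ := hT Z hZm.1
      obtain ⟨h, hh⟩ := Finset.card_eq_one.1 (card_sdiff_eq_one_of_chord P₁ hZ3 hZ2)
      have hhZ : h ∈ Z \ P₁ := hh ▸ Finset.mem_singleton_self h
      have hhZ' : h ∈ Z' \ P₁ := by
        rw [← hZZ']
        exact hhZ
      have hhp : h ≠ p := fun e => (Finset.mem_sdiff.1 hhZ).2 (e ▸ hpP)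
      have hsub : ({h, p} : Finset β) ⊆ Z ∩ Z' := by
        intro u hu
        simp only [Finset.mem_insert, Finset.mem_singleton] at hu
        rcases hu with rfl | rfl
        · exact Finset.mem_inter.2 ⟨(Finset.mem_sdiff.1 hhZ).1, (Finset.mem_sdiff.1 hhZ').1⟩
        · exact Finset.mem_inter.2 ⟨hZm.2, hZ'm.2⟩
      have := Finset.card_le_card hsub
      rw [Finset.card_pair hhp] at this
      have := hpair Z hZm.1 Z' hZ'm.1 hne
      omega
    exact Finset.card_le_card_of_injOn _ hmaps hinj
  refine (Finset.sum_le_sum hdeg).trans ?_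
  rw [Finset.sum_const_nat (m := (T.image (fun Z => Z \ P₁)).card) (fun _ _ => rfl)]
  rfl

section ThreeMeet

variable {w : β → ℕ} {ls : Finset (Finset β)}
  (h1 : ∀ L ∈ ls, ∀ v ∈ L, w v = 1 ∨ w v = 2)
  (h2 : ∀ L ∈ ls, 3 ≤ L.card ∧ wsum w L ≤ 5)
  (h3 : ∀ L ∈ ls, ∀ L' ∈ ls, L ≠ L' → (L ∩ L').card ≤ 1)
  (h4 : ∀ l : List (Finset β), l.Nodup → (∀ L ∈ l, L ∈ ls) → wsum w (unionL l) ≤ 8 + lineRank l)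
  (h5 : ∀ l : List (Finset β), l.Nodup → (∀ L ∈ l, L ∈ ls) → lineRank l ≤ 3 → (unionL l).card ≤ 9)
  {A B C : Finset β} (hA : A ∈ ls) (hB : B ∈ ls) (hC : C ∈ ls)
  (hBA : B ≠ A) (hCA : C ≠ A) (hCB : C ≠ B)
  (cA : 4 ≤ A.card) (cB : 4 ≤ B.card) (cC : 4 ≤ C.card)
  (hrest : ∀ L ∈ ls, L ≠ A → L ≠ B → L ≠ C → L.card = 3)
  (hmeet : (B ∩ A).card = 1)
  (hnt : ∀ l : List (Finset β), l.Nodup → (∀ L ∈ l, L ∈ ls) → lineRank l ≤ 3 → A ∈ l → B ∈ l → C ∉ l)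

include h1 h2 h3 h4 h5 hA hB hC hBA hCA hCB cA cB cC hrest hmeet hnt in
/-- **(A1) at nullity `8`, exact: two of three big lines meet, the third is in no plane with them: cap sum
`≤ 23`** (sharpening `sum_cap_le_twenty_five_of_three_big_meet`). -/
theorem sum_cap_le_twenty_three_of_three_big_meet : ∑ L ∈ ls, capPaper L.card (fat w L) ≤ 23 := by
  have h2' := two_le_card_of_spec₇ h2
  obtain ⟨l, hnd, hls, hr, hsub, hmax⟩ := exists_plane ls _ [B, A] le_rfl (by simp [hBA]) (by simp [hA, hB])
    (by rw [lineRank_pair_eq_three (h2' A hA) (h2' B hB) hmeet])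
  have hc9 : (unionL l).card ≤ 9 := card_plane_le_nine h5 hnd hls hr
  have hAl : A ∈ l := hsub A (by simp)
  have hBl : B ∈ l := hsub B (by simp)
  have hCl : C ∉ l := hnt l hnd hls hr hAl hBl
  have hCP : (C ∩ unionL l).card ≤ 1 := hmax C hC hCl
  have hU : A ∪ B ⊆ unionL l := by
    intro v hv
    rcases Finset.mem_union.1 hv with h | h
    · exact mem_unionL_iff.2 ⟨A, hAl, h⟩
    · exact mem_unionL_iff.2 ⟨B, hBl, h⟩
  have hu := Finset.card_union_add_card_inter A B
  rw [Finset.inter_comm] at hu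
  have hcU := Finset.card_le_card hU
  have hHc := Finset.card_sdiff_add_card_eq_card hU
  -- the plane's cost and the third line's
  have hcs := wsum_unionL_eq w l (fun L hL => h1 L (hls L hL)) (fun L hL => h2' L (hls L hL))
  rw [wsum_eq_card_add_fat w (unionL l) (fun v hv => by
    obtain ⟨L, hL, hvL⟩ := mem_unionL_iff.1 hv
    exact h1 L (hls L hL) v hvL)] at hcs
  have hcostC := costSum_le h1 h2' h4 (C :: l) (List.nodup_cons.2 ⟨hCl, hnd⟩) (fun L hL => by
    rcases List.mem_cons.1 hL with rfl | hL
    · exact hC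
    · exact hls L hL)
  simp only [costSum] at hcostC
  rw [lineCost_of_inter_le_two (le_trans hCP (by omega))] at hcostC
  -- the fat points of the plane
  have hfatin := sum_fat_plane_le₃ w l (fun L hL => (h2 L (hls L hL)).1)
    (fun L hL L' hL' hne => h3 L (hls L hL) L' (hls L' hL') hne)
  -- the chords of the plane
  set S := (l.toFinset.erase A).erase B with hS
  have hSmem : ∀ X ∈ S, X ∈ l ∧ X ≠ A ∧ X ≠ B := fun X hX => by
    have a := Finset.mem_erase.1 hX; have b := Finset.mem_erase.1 a.2
    exact ⟨List.mem_toFinset.1 b.2, b.1, a.1⟩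
  have hSC : ∀ X ∈ S, X ≠ C := fun X hX h => hCl (h ▸ (hSmem X hX).1)
  have hS3 : ∀ X ∈ S, X.card = 3 := fun X hX =>
    hrest X (hls X (hSmem X hX).1) (hSmem X hX).2.1 (hSmem X hX).2.2 (hSC X hX)
  have hchords := card_chords_le (L₁ := A) (L₂ := B) S (fun X hX => by
    obtain ⟨hXl, hX1, hX2⟩ := hSmem X hX
    exact ⟨hS3 X hX, fun v hv => mem_unionL_iff.2 ⟨X, hXl, hv⟩, h3 X (hls X hXl) A hA hX1,
      h3 X (hls X hXl) B hB hX2⟩)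
    (fun X hX X' hX' hne => h3 X (hls X (hSmem X hX).1) X' (hls X' (hSmem X' hX').1) hne)
  -- the lines outside `(C ∪ unionL l) = C ∪ Π`
  set T := (ls.filter (fun L => L ∉ l)).erase C with hT
  have hTmem : ∀ L ∈ T, L ∈ ls ∧ L ∉ l ∧ L ≠ C := fun L hL => by
    have a := Finset.mem_erase.1 hL; have b := Finset.mem_filter.1 a.2
    exact ⟨b.1, b.2, a.1⟩
  have hT3 : ∀ L ∈ T, L.card = 3 := fun L hL => hrest L (hTmem L hL).1
    (fun h => (hTmem L hL).2.1 (h ▸ hAl)) (fun h => (hTmem L hL).2.1 (h ▸ hBl)) (hTmem L hL).2.2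
  have hTPi : ∀ L ∈ T, (L ∩ unionL l).card ≤ 1 := fun L hL => hmax L (hTmem L hL).1 (hTmem L hL).2.1
  have hTC : ∀ L ∈ T, (L ∩ C).card ≤ 1 := fun L hL => h3 L (hTmem L hL).1 C hC (hTmem L hL).2.2
  have hTP : ∀ L ∈ T, (L ∩ (C ∪ unionL l)).card ≤ 2 := fun L hL => by
    have := card_inter_union_le L C (unionL l)
    have := hTPi L hL
    have := hTC L hL
    omega
  have hk : ∀ t : List (Finset β), t.Nodup → (∀ L ∈ t, L ∈ T) →
      freeCountR (C ∪ unionL l) t + fat w (unionLR (C ∪ unionL l) t \ (C ∪ unionL l)) +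
        ((unionL l).card + fat w (unionL l) + C.card + fat w (C \ unionL l)) ≤ 13 := by
    intro t hndt hlt
    have hb := budget_of_prefix h1 h2' h4 (C :: l) t (by
      rw [List.nodup_append']
      refine ⟨hndt, List.nodup_cons.2 ⟨hCl, hnd⟩, fun L hLt hLl => ?_⟩
      rcases List.mem_cons.1 hLl with rfl | hLl
      · exact (hTmem L (hlt L hLt)).2.2 rfl
      · exact (hTmem L (hlt L hLt)).2.1 hLl)
      (fun L hL => by
        rcases List.mem_append.1 hL with hL | hL
        · exact (hTmem L (hlt L hL)).1
        rcases List.mem_cons.1 hL with rfl | hL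
        · exact hC
        · exact hls L hL)
      (fun L hL => hT3 L (hlt L hL))
    simp only [costSum, unionL] at hb
    rw [lineCost_of_inter_le_two (le_trans hCP (by omega))] at hb
    have hsplit := fat_sdiff_add_fat_of_subset w (subset_unionLR (C ∪ unionL l) t)
    have hsplitC : fat w (C \ unionL l) + fat w (unionL l) = fat w (C ∪ unionL l) := by
      have h := fat_sdiff_add_fat_of_subset w (P₀ := unionL l) (U := C ∪ unionL l) Finset.subset_union_right
      rwa [Finset.union_sdiff_right] at h
    omega
  have hsplitC : fat w (C \ unionL l) + fat w (unionL l) = fat w (C ∪ unionL l) := by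
    have h := fat_sdiff_add_fat_of_subset w (P₀ := unionL l) (U := C ∪ unionL l) Finset.subset_union_right
    rwa [Finset.union_sdiff_right] at h
  have hcost13 : (unionL l).card + fat w (unionL l) + C.card + fat w (C \ unionL l) ≤ 13 := by omega
  set b' := 13 - (unionL l).card - fat w (unionL l) - C.card - fat w (C \ unionL l) with hb'
  -- the split of `T` into bridge chords and thin lines
  set Tα := T.filter (fun L => (L ∩ (C ∪ unionL l)).card = 2) with hTα
  set Tβ := T.filter (fun L => ¬ (L ∩ (C ∪ unionL l)).card = 2) with hTβ
  have hTαmem : ∀ L ∈ Tα, L ∈ T ∧ (L ∩ (C ∪ unionL l)).card = 2 := fun L hL => Finset.mem_filter.1 hL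
  have hTβmem : ∀ L ∈ Tβ, L ∈ T ∧ (L ∩ (C ∪ unionL l)).card ≤ 1 := fun L hL => by
    have h := Finset.mem_filter.1 hL
    exact ⟨h.1, by have := hTP L h.1; omega⟩
  -- the thin family
  have hβ := two_mul_sum_cap_thin_le w (C ∪ unionL l) Tβ (b := b')
    (fun L hL => ⟨hT3 L (hTβmem L hL).1, (hTβmem L hL).2⟩)
    (fun L hL L' hL' hne => h3 L (hTmem L (hTβmem L hL).1).1 L' (hTmem L' (hTβmem L' hL').1).1 hne)
    (fun L hL => h1 L (hTmem L (hTβmem L hL).1).1) (fun L hL => (h2 L (hTmem L (hTβmem L hL).1).1).2)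
    (fun t hndt hlt => by have := hk t hndt (fun L hL => (hTβmem L (hlt L hL)).1); omega)
  -- the chord family: hubs and the second coordinate in `C ∖ Π`
  have hKP : C \ unionL l ⊆ (C ∪ unionL l) := fun v hv => Finset.mem_union_left _ (Finset.mem_sdiff.1 hv).1
  have hKc := Finset.card_sdiff_add_card_inter C (unionL l)
  have hTαK : ∀ Z ∈ Tα, (Z ∩ (C \ unionL l)).card = 1 := by
    intro Z hZ
    obtain ⟨hZT, hZ2⟩ := hTαmem Z hZ
    have hZPi := hTPi Z hZT
    have hZC := hTC Z hZT
    have hcov : Z ∩ (C ∪ unionL l) = (Z ∩ C) ∪ (Z ∩ unionL l) := by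
      ext v; simp only [Finset.mem_inter, Finset.mem_union]; tauto
    have hu' := Finset.card_union_add_card_inter (Z ∩ C) (Z ∩ unionL l)
    rw [← hcov] at hu'
    have hZK : Z ∩ (C \ unionL l) = (Z ∩ C) \ ((Z ∩ C) ∩ (Z ∩ unionL l)) := by
      ext v; simp only [Finset.mem_inter, Finset.mem_sdiff]; tauto
    rw [hZK, Finset.card_sdiff_of_subset Finset.inter_subset_left]
    omega
  have hTαT : ∀ Z ∈ Tα, Z.card = 3 ∧ (Z ∩ (C ∪ unionL l)).card = 2 := fun Z hZ =>
    ⟨hT3 Z (hTαmem Z hZ).1, (hTαmem Z hZ).2⟩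
  have hTαpair : ∀ Z ∈ Tα, ∀ Z' ∈ Tα, Z ≠ Z' → (Z ∩ Z').card ≤ 1 := fun Z hZ Z' hZ' hne =>
    h3 Z (hTmem Z (hTαmem Z hZ).1).1 Z' (hTmem Z' (hTαmem Z' hZ').1).1 hne
  have hN := card_hubs_add_sum_fat_le w (C ∪ unionL l) hTαT (b := b')
    (fun t hndt hlt => by have := hk t hndt (fun L hL => (hTαmem L (hlt L hL)).1); omega)
  have hTαcard := card_le_card_hubs_mul (C ∪ unionL l) hTαT hTαpair (C \ unionL l) hKP hTαK
  have hTαfat := sum_fat_sdiff_le w (C ∪ unionL l) hTαT hTαpair (C \ unionL l) hKP hTαK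
  have hTαcap : ∑ Z ∈ Tα, capPaper Z.card (fat w Z) =
      Tα.card + ∑ Z ∈ Tα, fat w (Z \ (C ∪ unionL l)) + ∑ Z ∈ Tα, fat w (Z ∩ (C ∪ unionL l)) := by
    have hcap : ∀ Z ∈ Tα, capPaper Z.card (fat w Z) = 1 + (fat w (Z \ (C ∪ unionL l)) + fat w (Z ∩ (C ∪ unionL l))) := by
      intro Z hZ
      have hZls := (hTmem Z (hTαmem Z hZ).1).1
      have hZ3 := (hTαT Z hZ).1
      have hws := wsum_eq_card_add_fat w Z (h1 Z hZls)
      have h5' := (h2 Z hZls).2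
      rw [hZ3, capPaper_three_eq' (by omega), fat_eq_fat_sdiff_add_fat_inter w Z (C ∪ unionL l)]
    rw [Finset.sum_congr rfl hcap, Finset.sum_add_distrib, Finset.sum_add_distrib,
      Finset.sum_const_nat (m := 1) (fun _ _ => rfl), Nat.mul_one, Nat.add_assoc]
  have hTαinter := sum_fat_inter_le_hubs w (C ∪ unionL l) hTαT hTαpair
  -- the sum: the plane, `C`, the chords, the thin lines
  have hsplit := Finset.sum_filter_add_sum_filter_not ls (fun L => L ∈ l) (fun L => capPaper L.card (fat w L))
  have hfil : ls.filter (fun L => L ∈ l) = l.toFinset := by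
    ext L
    simp only [Finset.mem_filter, List.mem_toFinset]
    exact ⟨fun h => h.2, fun h => ⟨hls L h, h⟩⟩
  rw [hfil] at hsplit
  have hsC := Finset.add_sum_erase (ls.filter (fun L => L ∉ l)) (fun L => capPaper L.card (fat w L))
    (Finset.mem_filter.2 ⟨hC, hCl⟩)
  rw [← hT] at hsC
  have hsT := Finset.sum_filter_add_sum_filter_not T (fun L => (L ∩ (C ∪ unionL l)).card = 2)
    (fun L => capPaper L.card (fat w L))
  rw [← hTα, ← hTβ] at hsT
  rw [← hsplit, ← hsC, ← hsT, capPaper_big_eq h1 h2 hC cC]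
  have hAf : A ∈ l.toFinset := List.mem_toFinset.2 hAl
  have hBf : B ∈ l.toFinset.erase A := Finset.mem_erase.2 ⟨hBA, List.mem_toFinset.2 hBl⟩
  have esum : ∀ f : Finset β → ℕ, ∑ L ∈ l.toFinset, f L = f A + (f B + ∑ X ∈ S, f X) := by
    intro f
    rw [← Finset.add_sum_erase _ f hAf, ← Finset.add_sum_erase _ f hBf]
  have hcap3 : ∀ X ∈ S, capPaper X.card (fat w X) = 1 + fat w X := by
    intro X hX
    have hXls := hls X (hSmem X hX).1
    have := wsum_eq_card_add_fat w X (h1 X hXls)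
    have := (h2 X hXls).2
    have hX3 := hS3 X hX
    rw [hX3, capPaper_three_eq' (by omega)]
  have hSfat : ∑ X ∈ S, fat w X ≤ 2 * S.card := by
    have : ∀ X ∈ S, fat w X ≤ 2 := fun X hX => by
      have hXls := hls X (hSmem X hX).1
      have := wsum_eq_card_add_fat w X (h1 X hXls)
      have := (h2 X hXls).2
      have := hS3 X hX
      omega
    refine (Finset.sum_le_sum this).trans ?_
    rw [Finset.sum_const_nat (m := 2) (fun _ _ => rfl)]
    omega
  rw [esum, capPaper_big_eq h1 h2 hA cA, capPaper_big_eq h1 h2 hB cB, Finset.sum_congr rfl hcap3,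
    Finset.sum_add_distrib, Finset.sum_const_nat (m := 1) (fun _ _ => rfl), Nat.mul_one]
  rw [esum] at hfatin
  -- the fat of the big lines
  have hwA := wsum_eq_card_add_fat w A (h1 A hA)
  have hwB := wsum_eq_card_add_fat w B (h1 B hB)
  have hwC := wsum_eq_card_add_fat w C (h1 C hC)
  have hA5 := (h2 A hA).2
  have hB5 := (h2 B hB).2
  have hC5 := (h2 C hC).2
  have hfAB := fat_union_add_fat_inter w A B
  have hfABle : fat w (A ∪ B) ≤ fat w (unionL l) := fat_mono w hU
  have hfABi : fat w (A ∩ B) ≤ 1 := by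
    have := fat_le_card w (A ∩ B)
    have hAB1 : (A ∩ B).card = 1 := by rw [Finset.inter_comm]; exact hmeet
    omega
  have hCsplit := fat_eq_fat_sdiff_add_fat_inter w C (unionL l)
  have hCinter : fat w (C ∩ unionL l) ≤ (C ∩ unionL l).card := fat_le_card w _
  -- the chord family's cap: `≤ |K| · b′ + #hubs · fat (C ∪ unionL l)`
  have hα : ∑ Z ∈ Tα, capPaper Z.card (fat w Z) ≤
      (C \ unionL l).card * b' + (Tα.image (fun Z => Z \ (C ∪ unionL l))).card * fat w (C ∪ unionL l) := by
    set nN := (Tα.image (fun Z => Z \ (C ∪ unionL l))).card with hnN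
    set sN := ∑ n ∈ Tα.image (fun Z => Z \ (C ∪ unionL l)), fat w n with hsN
    have e1 : nN * (C \ unionL l).card + (C \ unionL l).card * sN = (C \ unionL l).card * (nN + sN) := by ring
    have e2 : (C \ unionL l).card * (nN + sN) ≤ (C \ unionL l).card * b' := Nat.mul_le_mul_left _ (by omega)
    have e3 : fat w (C ∪ unionL l) * nN = nN * fat w (C ∪ unionL l) := by ring
    omega
  have hnNb : (Tα.image (fun Z => Z \ (C ∪ unionL l))).card ≤ b' := by omega
  -- the table
  have hb2 : b' ≤ 2 := by omega
  clear hk hsplit hsC hsT hfil esum hcap3 hmax hsub hls hnd hnt hTP hTPi hTC hTmem hT3 hSmem hSC hS3 hTαmem hTβmem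
    hTαK hTαT hTαpair hN hTαcard hTαfat hTαcap hKP
  clear_value b'
  generalize hc : (unionL l).card = c at *
  generalize hf : fat w (unionL l) = f₀ at *
  generalize hkC : C.card = kC at *
  generalize hfC : fat w (C \ unionL l) = fC at *
  generalize hiC : (C ∩ unionL l).card = iC at *
  generalize hkK : (C \ unionL l).card = kK at *
  generalize hPf : fat w (C ∪ unionL l) = fP at *
  generalize hnN : (Tα.image (fun Z => Z \ (C ∪ unionL l))).card = nN at hα hnNb
  generalize (unionL l \ (A ∪ B)).card = e at *
  generalize (A ∪ B).card = u at *
  generalize S.card = s at *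
  generalize ∑ X ∈ S, fat w X = d at *
  generalize fat w A = a at *
  generalize fat w B = b at *
  generalize fat w C = fCt at *
  generalize fat w (C ∩ unionL l) = fCi at *
  generalize fat w (A ∪ B) = fAB at *
  generalize fat w (A ∩ B) = fABi at *
  generalize A.card = kA at *
  generalize B.card = kB at *
  generalize ∑ Z ∈ Tα, capPaper Z.card (fat w Z) = sα at *
  generalize ∑ Z ∈ Tβ, capPaper Z.card (fat w Z) = sβ at *
  have hc7 : 7 ≤ c := by omega
  have hkC5 : kC ≤ 5 := by omega
  interval_cases c <;> interval_cases kC <;> interval_cases b' <;> interval_cases nN <;> omega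

end ThreeMeet

end Eight

end FourCap

end S1

end PercRepro
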